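import Mathlib
import Summits.KontsevichZagierPeriods.KontsevichZagierPeriods.Theorems.SoloInformedLogRoomBand
import HarnessLib

/-!
# Solo-informed (A390-ii): THEOREM T' — logarithmic room in ℚ-semialgebraic integrals

File F4i of the KERNEL LEMMA I programme: the induction.  **Theorem** (conditional on the vendored
Lion–Rolin preparation fact `semialgebraicPreparation`): for all `k m`, `SoloInformedLogRoomAt k m`
— if `S ⊆ ℝ^{k+m}` is `ℚ`-semialgebraic, `F ≥ 0` and the finite family `ρᵢ` are `ℚ`-semialgebraic on
`S`, and `∫ 1_S F (t, x) dx < ∞` for a parameter `t ∈ ℝ^k`, then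
`∫ 1_S F (1 + Σᵢ |log ρᵢ|)ᵖ (t, x) dx < ∞` for every `p`.

The step `m → m + 1` covers `S` by prepared bands and graphs (`soloInformed_preparedCover`);
graphs are null, and each band is `soloInformed_band_lt_top`.
-/

open MeasureTheory Set Real
open scoped ENNReal
open Literature.ModelTheory.ExponentialFields Literature.NumberTheory.Transcendental

namespace Summit.KontsevichZagierPeriods.KontsevichZagierPeriods.Theorems

/-- Base of the induction: over `ℝ⁰` every integral is a point value. -/
theorem soloInformed_logRoom_zero (k : ℕ) : SoloInformedLogRoomAt k 0 := by
  intro ι _ p S F ρ t hS hF hρ hF0 hfin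
  exact (soloInformed_lintegral_fin_zero (fun x : Fin 0 → ℝ => ENNReal.ofReal
    (S.indicator (fun w => F w * (1 + ∑ i, |Real.log (ρ i w)|) ^ p) (Fin.append t x)))).trans_lt
    ENNReal.ofReal_lt_top

/-- An `ℝ≥0∞`-valued extension by zero is its own restriction to the set. -/
theorem soloInformed_indicator_ofReal_indicator {α : Type*} (S : Set α) (G : α → ℝ) :
    S.indicator (fun z => ENNReal.ofReal (S.indicator G z)) = fun z => ENNReal.ofReal (S.indicator G z) := by
  funext z
  by_cases hz : z ∈ S
  · rw [indicator_of_mem hz]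
  · rw [indicator_of_notMem hz, indicator_of_notMem hz, ENNReal.ofReal_zero]

/-- **Inductive step** of THEOREM T': `SoloInformedLogRoomAt k m → SoloInformedLogRoomAt k (m + 1)`,
granted the preparation fact. -/
theorem soloInformed_logRoom_succ (hprep : semialgebraicPreparation) {k m : ℕ}
    (ih : SoloInformedLogRoomAt k m) : SoloInformedLogRoomAt k (m + 1) := by
  intro ι _ p S F ρ t hS hF hρ hF0 hfin
  classical
  -- the integrands as measurable `ℝ≥0∞`-valued functions
  have hFm : Measurable (S.indicator F) := soloInformed_measurable_indicator_sa hS hF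
  have hρm : ∀ i, Measurable (S.indicator (ρ i)) := fun i =>
    soloInformed_measurable_indicator_sa hS (hρ i)
  have hSm : MeasurableSet S := hS.measurableSet_holds
  have hΦm : Measurable fun z => ENNReal.ofReal
      (S.indicator (fun w => F w * (1 + ∑ i, |Real.log (ρ i w)|) ^ p) z) :=
    ENNReal.measurable_ofReal.comp
      (soloInformed_measurable_indicator_logWeight subset_rfl hSm hFm hρm p)
  have hΦ₀m : Measurable fun z => ENNReal.ofReal (S.indicator F z) :=
    ENNReal.measurable_ofReal.comp hFm
  -- the family `(F, ρ)` indexed by `Fin (N + 1)` and its prepared cover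
  set e := Fintype.equivFin ι with he
  set f : Fin (Fintype.card ι + 1) → (Fin (k + m + 1) → ℝ) → ℝ :=
    Fin.cases F (fun i => ρ (e.symm i)) with hf
  have hfsa : ∀ i, IsSemialgebraicFunOn ℚ S (f i) := fun i => by
    refine Fin.cases ?_ (fun i => ?_) i
    · exact hF
    · exact hρ (e.symm i)
  obtain ⟨κT, _, B, l, ξ, j, κ'T, _, B', η, hB, hξ, hsub, hB', hη, hcov, hprepd⟩ :=
    soloInformed_preparedCover hprep (n := k + m) (Fintype.card ι) hS f hfsa
  -- reduce the goal to the cover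
  suffices key : ∫⁻ x : Fin (m + 1) → ℝ, S.indicator (fun z => ENNReal.ofReal
      (S.indicator (fun w => F w * (1 + ∑ i, |Real.log (ρ i w)|) ^ p) z))
      (Fin.append t x : Fin (k + (m + 1)) → ℝ) < ∞ by
    rw [soloInformed_indicator_ofReal_indicator S] at key
    exact key
  refine soloInformed_cover_lintegral_lt_top (ι := κT ⊕ κ'T) (B := S)
    (Sum.elim (fun κ => bandOver (B κ) (ξ κ) (j κ)) (fun κ' => graphOver (B' κ') (η κ')))
    (fun z hz => ?_) ?_ hΦm t ?_
  · -- cover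
    rcases hcov hz with h | h
    · obtain ⟨κ, hκ⟩ := mem_iUnion.mp h
      exact mem_iUnion.mpr ⟨Sum.inl κ, hκ⟩
    · obtain ⟨κ', hκ'⟩ := mem_iUnion.mp h
      exact mem_iUnion.mpr ⟨Sum.inr κ', hκ'⟩
  · -- measurability of the pieces
    rintro (κ | κ')
    · exact (soloInformed_isSemialgebraic_bandOver (hB κ) (hξ κ) (j κ)).measurableSet_holds
    · exact ((isSemialgebraicFunOn_iff_isSemialgebraic_graphOver).mp (hη κ')).measurableSet_holds
  · -- finiteness piece by piece
    rintro (κ | κ')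
    · -- a prepared band
      have hprepF : IsLRPreparedOn (B κ) (bandOver (B κ) (ξ κ) (j κ)) F := hprepd κ 0
      have hprepρ : ∀ i, IsLRPreparedOn (B κ) (bandOver (B κ) (ξ κ) (j κ)) (ρ i) := fun i => by
        have h := hprepd κ (e i).succ
        simpa [hf, Fin.cases_succ, Equiv.symm_apply_apply] using h
      have d₀ : SoloInformedLRData (B κ) (bandOver (B κ) (ξ κ) (j κ)) F :=
        Classical.choice (soloInformed_lrData_nonempty hprepF)
      have d : ∀ i, SoloInformedLRData (B κ) (bandOver (B κ) (ξ κ) (j κ)) (ρ i) := fun i =>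
        Classical.choice (soloInformed_lrData_nonempty (hprepρ i))
      refine soloInformed_band_lt_top ih (hB κ) (hξ κ) (j κ) p d₀ d hΦm hΦ₀m
        (fun z hz => by rw [indicator_of_mem (hsub κ hz)])
        (fun z hz => by rw [indicator_of_mem (hsub κ hz), abs_of_nonneg (hF0 z (hsub κ hz))])
        t (lt_of_le_of_lt (lintegral_mono fun x => indicator_le_self _ _ _) hfin)
    · -- a graph is null
      rw [show Sum.elim (fun κ => bandOver (B κ) (ξ κ) (j κ)) (fun κ' => graphOver (B' κ') (η κ'))
          (Sum.inr κ') = graphOver (B' κ') (η κ') from rfl,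
        soloInformed_lintegral_graphOver_append
          (soloInformed_measurable_indicator_sa (hB' κ') (hη κ')) _ t]
      exact ENNReal.zero_lt_top

/-- **THEOREM T' (logarithmic room)**, conditional on the Lion–Rolin preparation fact: integrable
non-negative `ℚ`-semialgebraic functions absorb powers of logarithms of `ℚ`-semialgebraic functions,
uniformly in a parameter block of length `k`. -/
theorem soloInformed_logRoom (hprep : semialgebraicPreparation) (k : ℕ) :
    ∀ m, SoloInformedLogRoomAt k m
  | 0 => soloInformed_logRoom_zero k
  | m + 1 => soloInformed_logRoom_succ hprep (soloInformed_logRoom hprep k m)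

end Summit.KontsevichZagierPeriods.KontsevichZagierPeriods.Theorems
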